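import Summits.Ventures.LatticeQCDFlow.Scaling.SwapAcceptanceOptimumDEO
import Summits.Ventures.LatticeQCDFlow.Scaling.SwapAcceptanceOptimumSharp

/-!
HONEST FRAMING: exact (Metropolis-corrected) sampling algorithms for lattice gauge theory; figures
of merit are autocorrelation/cost numbers at stated couplings and volumes; no continuum-physics
claim.

# SwapAcceptanceOptimumDEOvsSEO — THE DEO-MODEL EFFICIENCY DOMINATES THE REVERSIBLE ONE AT EVERY SPACING AND
# PEAKS AT A SMALLER SPACING (`uDeo < u⋆`, `a⋆ < aDeo`, number-free); AT GEN-4's REVERSIBLE OPTIMUM `a⋆ ≈ 0.234`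
# IT KEEPS MORE THAN `83 %` OF ITS OWN OPTIMUM, AT THE CARD's `20 %` MORE THAN `78 %`: IN THE DRIVER's SCHEME THE
# MODEL GAIN FROM RE-TUNING `0.20 → 0.234` IS SMALL, THE MODEL OPTIMUM LYING NEAR `0.39`
# (row 22 `su3-ptbc`, GEN-5 + GEN-7 §0, ours; corollary of `SwapAcceptanceOptimumDEO` + `SwapAcceptanceOptimumSharp`)

Venture `LatticeQCDFlow` (cell pub-lqcd), topic `Scaling`; FANOUT row 22.  §0 is structural (GEN-4's
`SwapSpacingOptimum`: `swapEff`, `swapCrit`, `uOpt`, `aOpt`, `swapCrit_uOpt`, `swapCrit_neg_of_uOpt_lt`,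
`strictAnti_erfc`; GEN-5's `SwapSpacingOptimumDEO` / `SwapAcceptanceOptimumDEO`: `deoEff`, `deoCrit`,
`deoCrit_eq_swapCrit`, `deoCrit_pos_of_lt_uDeo`, `deoCrit_uDeo`, `uDeo`, `aDeo`); §1 is certified numerics only:
`uOpt_mem_Ioo_sharp` (`0.840 < u⋆ < 0.8425`), `aOpt_sharp` (`0.2334 < a⋆ < 0.2349`) and `deoEff_uDeo_lt`
(`deoEff uDeo < 0.257`).  Nothing is cited as a fact.

* §0 (number-free) `deoEff_eq_swapEff_div` (`deoEff = swapEff/erf`), **`swapEff_lt_deoEff`** (`u > 0`: per pair the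
  DEO model is strictly more efficient — the profile-free saving `RT_SEO − RT_DEO = 2(K+1)(K−1)` of
  `SwapLadderRoundTripDEO` seen at the level of the efficiency functionals); `deoCrit_lt_two_mul_swapCrit`,
  `deoCrit_uOpt` (`= −2a⋆²`), `deoCrit_neg_of_uOpt_le`; **`uDeo_lt_uOpt`** and **`aOpt_lt_aDeo`**: the DEO-model
  optimum sits at a strictly SMALLER reduced spacing / LARGER acceptance than the reversible optimum, for the exact
  `erfc` model with no bracket arithmetic.
* §1 `deoEff_uOpt_eq` — `deoEff u⋆ = u⋆²·a⋆/(1 − a⋆)`; **`deoEff_uOpt_gt`** — `deoEff u⋆ > 0.2148`;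
  **`deoEff_uOpt_gt_mul`** — `deoEff u⋆ > 0.83·deoEff uDeo`.
NOT CLAIMED: that either model describes PTBC; any number of a run.
-/

noncomputable section

open Real Set
open Literature.Analysis.SpecialFunctions (erf)
open Literature.ComputerArithmetic.BrentZimmermann2010.AsymptoticExpansions (erfc erfc_pos)

namespace Summit.Ventures.LatticeQCDFlow.Scaling

/-! ## §0 Structural comparison with the reversible scheme (number-free) -/

/-- `deoEff u = swapEff u / erf u`. [ours] -/
theorem deoEff_eq_swapEff_div (u : ℝ) : deoEff u = swapEff u / erf u := rfl

/-- **`swapEff u < deoEff u` for `u > 0`** (`0 < erf u < 1`; relative gain `erfc/erf = a/(1 − a)`). [ours] -/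
theorem swapEff_lt_deoEff {u : ℝ} (hu : 0 < u) : swapEff u < deoEff u := by
  rw [deoEff_eq_swapEff_div, lt_div_iff₀ (erf_pos_of_pos hu)]
  have hs : 0 < swapEff u := mul_pos (pow_pos hu 2) (erfc_pos u)
  have he : erf u < 1 := by rw [erf_eq_one_sub_erfc]; linarith [erfc_pos u]
  nlinarith

/-- `deoCrit u < 2·swapCrit u`. [ours] -/
theorem deoCrit_lt_two_mul_swapCrit (u : ℝ) : deoCrit u < 2 * swapCrit u := by
  rw [deoCrit_eq_swapCrit]; nlinarith [erfc_pos u]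

/-- `deoCrit u⋆ = −2·a⋆²`. [ours] -/
theorem deoCrit_uOpt : deoCrit uOpt = -(2 * aOpt ^ 2) := by
  rw [deoCrit_eq_swapCrit, swapCrit_uOpt]; unfold aOpt; ring

/-- **Past the reversible optimum the DEO critical function is negative**: `u⋆ ≤ u ⇒ deoCrit u < 0`. [ours] -/
theorem deoCrit_neg_of_uOpt_le {u : ℝ} (hu : uOpt ≤ u) : deoCrit u < 0 := by
  rcases hu.eq_or_lt with h | h
  · rw [← h, deoCrit_uOpt]; have := aOpt_pos; nlinarith
  · linarith [deoCrit_lt_two_mul_swapCrit u, swapCrit_neg_of_uOpt_lt h]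

/-- **`uDeo < u⋆`: the DEO-model optimum lies at a strictly smaller reduced spacing than the reversible one**
(`deoCrit u⋆ < 0` while `deoCrit ≥ 0` on `(0, uDeo]`). [ours] -/
theorem uDeo_lt_uOpt : uDeo < uOpt := by
  by_contra h
  rcases (not_lt.mp h).eq_or_lt with heq | hlt
  · have h0 := deoCrit_neg_of_uOpt_le le_rfl
    rw [heq, deoCrit_uDeo] at h0
    exact lt_irrefl _ h0
  · linarith [deoCrit_pos_of_lt_uDeo uOpt_pos hlt, deoCrit_neg_of_uOpt_le le_rfl]

/-- **`a⋆ < aDeo`: the DEO-model optimal acceptance exceeds the reversible one** (`erfc` strictly decreasing;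
number-free — GEN-5's bracket route gave `a⋆ < 0.2349 < 0.372 < aDeo`). [ours] -/
theorem aOpt_lt_aDeo : aOpt < aDeo :=
  strictAnti_erfc uDeo_lt_uOpt

/-! ## §1 How much the reversible tuning loses under the DEO model (certified numerics) -/

/-- `deoEff u⋆ = u⋆²·a⋆/(1 − a⋆)` (`erf = 1 − erfc`, `a⋆ = erfc u⋆`). [ours] -/
theorem deoEff_uOpt_eq : deoEff uOpt = uOpt ^ 2 * aOpt / (1 - aOpt) := by
  unfold deoEff aOpt
  rw [erf_eq_one_sub_erfc]

/-- **`deoEff u⋆ > 0.2148`** (`u⋆ > 0.840`, `0.2334 < a⋆ < 0.2349`). [ours] -/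
theorem deoEff_uOpt_gt : (0.2148 : ℝ) < deoEff uOpt := by
  rw [deoEff_uOpt_eq]
  obtain ⟨hu, _⟩ := uOpt_mem_Ioo_sharp
  obtain ⟨ha1, ha2⟩ := aOpt_sharp
  have h1 : 0 < 1 - aOpt := by linarith
  rw [lt_div_iff₀ h1]
  have hu2 : (21 / 25 : ℝ) ^ 2 < uOpt ^ 2 := by nlinarith [uOpt_pos]
  nlinarith

/-- **At the reversible optimum the DEO-model efficiency keeps more than `83 %` of its own optimum**:
`deoEff u⋆ > 0.2148 > 0.83 · 0.257 > 0.83 · deoEff uDeo`. [ours] -/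
theorem deoEff_uOpt_gt_mul : 0.83 * deoEff uDeo < deoEff uOpt := by
  linarith [deoEff_uOpt_gt, deoEff_uDeo_lt]

end Summit.Ventures.LatticeQCDFlow.Scaling

end
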